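import Literature.AlgebraicGeometry.HodgeTheory.WeilClassesFieldProductsDecomposable
import Literature.AlgebraicGeometry.Milne1999.SpecialLefschetzGroupInvariantsHolds
import HarnessLib

/-!
# `W_F` decomposable ⟺ the Lefschetz group acts trivially on `W_F` ⟺ `S(A) ⊂ Sl_F(V)`, unconditionally; the §2 display
# for two Hom-orthogonal factors, unconditionally (Moonen–Zarhin 1998, Lemma (3), proof of Criterion (2), §2)

Layer `Literature/AlgebraicGeometry/HodgeTheory`, theorem-only junction of the seat's `WeilClassesFieldLefschetzGroup`
(Moonen–Zarhin's mechanism: `W_F ⊗ ℂ ≤ Dᵐ ⊗ ℂ` ⟹ every `u ∈ S(A)(ℂ)` fixes `W_F ⊗ ℂ` ⟹ `det(u | V_ρ) = 1`; and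
`S(A)(ℂ) ⊂ Sl_F` ⟹ `W_F ⊗ ℂ ≤ Bᵐ ⊗ ℂ`, landing in `Dᵐ ⊗ ℂ` only on the `B = D` locus), `WeilClassesFieldFLinear` (Lemma
(2) as an `iff` for a multiplicative pair), `WeilClassesFieldProductsDecomposable` (the §2 display «⟹» granted Milne's
Cor. 4.5 package `hrec` for the factor) with the tree's THEOREM
`Milne1999.mem_divisorClassesSpan_of_forall_mem_unitaryCentralizerGroup` (`Milne1999/SpecialLefschetzGroupInvariantsHolds`,
Milne 1999 Thm. 3.2 / Prop. 3.6 / Cor. 4.5 over `ℂ` for EVERY complex abelian variety and EVERY `h ∈ B¹(A) ⊗ ℂ` with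
`Q_h` non-degenerate: a class of `H^{2p}(A(ℂ); ℂ)` fixed by `⋀^{2p}u` for all `u ∈ S(A)(h)(ℂ) = unitaryCentralizerGroup A h`
is a Lefschetz class).  With it the conditional statements of those files become unconditional.  Everything is proved;
no definition, no named fact.

PRINTED STATEMENT.  B. J. J. Moonen – Yu. G. Zarhin, *Weil classes on abelian varieties*, J. reine angew. Math. 496
(1998) 83–92 = arXiv:alg-geom/9612017 (held text `paper:arxiv-alg-geom_9612017`).  §1, Lemma (3) (chunk p0003, lines
4–5): «`End(V_X)^{G_div(X)} = B`; `(⋀² V_X)^{G_div(X)} = 𝓑¹(X)`, and `(⊕_i ⋀^i V_X)^{G_div(X)} = 𝒟^•(X)`»; proof of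
Criterion (2) (chunk p0003, lines 62–70): «We claim that, in these cases, `G_div(X)` acts as the identity on `W_F` if and
only if `F ⊆ B`.  In the “only if” direction, this follows from Lemmas (2) and (3).  Conversely, suppose that `F ⊆ B`,
so that `G_div(X) ⊆ Gl_F(V_X)`.  In the cases we are considering, the group `G_div(X)` is connected and semi-simple, so
`G_div(X) ⊆ Sl_F(V_X)`, hence `G_div(X)` acts trivially on `W_F`» — i.e. THROUGHOUT THE PROOF: `W_F` consists of
decomposable classes ⟺ `G_div(X)` acts as the identity on `W_F` ⟺ `G_div(X) ⊆ Sl_F(V_X)` (Lemma (2): the action on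
`W_F` is through `det_F`); §2 (chunk p0002, lines 21–31): «if `W_F(X)` consists of Hodge classes, then: `W_F(X)` consists
of decomposable Hodge classes ⟺ each of the spaces `W_F(Yᵢ^{mᵢ})` consists of decomposable Hodge classes»; §1 (chunk
p0002, line 72): «The group `G_div(X)` does not depend on the choice of `λ`».

RENDERING.  As in the seat's files: `F = ℚ(φ)`, `P(φ) = 0` (`P ∈ ℤ[T]` monic irreducible of degree `e`), `e · 2m =
2 dim A`, `W_F ⊗ ℂ = weilClassesField A φ P (2m)`, `Dᵐ ⊗ ℂ = Barriers.HodgeConjecture.divisorClassesSpan A.X (dim A) m`,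
`Bᵐ ⊗ ℂ = VanGeemen1994.hodgeClassSpan`; Moonen–Zarhin's `G_div(X)(ℂ)` is read as Milne's `S(A)(ℂ) = unitaryCentralizerGroup
A h` (the automorphisms of `H¹(A(ℂ); ℂ)` commuting with every `ψ^*` and preserving `Q_h`; `F ⊆ End⁰(A)` always, so
«`F ⊆ B`» is automatic and `S(A)(ℂ) ⊆ Gl_F(V)(ℂ)`), `⋀^{2m}u = exteriorPullback _ u (2m)`, `det(u | V_ρ) = VanGeemen1994.
detOnEigenspace u φ^* _ ρ`.  Milne's Thm. 3.2 / Cor. 4.5 is the `S(A)`-form of Lemma (3)'s third clause (`S(A) ⊆ G_div`,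
and both fix `𝒟^•`), for any `h ∈ B¹(A) ⊗ ℂ` with `Q_h` non-degenerate (`hh`, `hnd`; a polarization class has both,
`Milne1999.exists_polarizationClass`).

WHAT IS PROVED.
* §1 LEMMA (3), THIRD CLAUSE, AS AN `iff` ON THE CARRIERS: **`mem_divisorClassesSpan_iff_forall_unitaryCentralizerGroup_
  exteriorPullback_eq`** — `c ∈ Dᵖ ⊗ ℂ ⟺ ⋀^{2p}u c = c` for every `u ∈ S(A)(h)(ℂ)` (Milne Thm. 4.4 + Thm. 3.2 / Cor. 4.5).
* §2 THE MECHANISM OF CRITERION (2), UNCONDITIONALLY: **`weilClassesField_le_divisorClassesSpan_iff_forall_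
  unitaryCentralizerGroup_exteriorPullback_eq`** («`W_F` decomposable ⟺ `G_div` acts as the identity on `W_F`»; no
  hypothesis on `P`, `φ`) and **`weilClassesField_le_divisorClassesSpan_iff_forall_detOnEigenspace_eq_one`** («⟺ `G_div ⊆
  Sl_F(V_X)`»: `W_F ⊗ ℂ ≤ Dᵐ ⊗ ℂ ⟺ det(u | V_ρ) = 1` for every `u ∈ S(A)(ℂ)` and every complex root `ρ` of `P`); the
  one-way forms `weilClassesField_le_divisorClassesSpan_of_forall_unitaryCentralizerGroup_exteriorPullback_eq` /
  `…_of_forall_unitaryCentralizerGroup_detOnEigenspace_eq_one` (the unconditional versions of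
  `WeilClassesFieldLefschetzGroup` §3, there only into `Bᵐ ⊗ ℂ` / on the `B = D` locus);
  `forall_detOnEigenspace_eq_one_iff_of_nondegenerate` — the condition `S(A)(h)(ℂ) ⊂ Sl_F` does not depend on `h`.
* §3 THE EXCEPTIONAL ALTERNATIVE AS AN `iff` (`m ≠ 0`): **`weilClassesField_inf_divisorClassesSpan_eq_bot_iff_exists_
  detOnEigenspace_ne_one`** — `W_F ⊗ ℂ ⊓ Dᵐ ⊗ ℂ = ⊥ ⟺` some `u ∈ S(A)(ℂ)` has `det(u | V_ρ) ≠ 1` at some root; and the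
  Hodge-but-exceptional locus **`weilClassesField_le_hodgeClassSpan_and_inf_eq_bot_iff`** — `W_F ⊗ ℂ ≤ Bᵐ ⊗ ℂ ∧ W_F ⊗ ℂ ⊓
  Dᵐ ⊗ ℂ = ⊥ ⟺ (n_ρ = n_ρ̄ ∀ρ) ∧ ∃ u ∈ S(A)(ℂ), ∃ρ, det(u | V_ρ) ≠ 1`.
* §4 THE §2 DISPLAY FOR TWO HOM-ORTHOGONAL FACTORS, UNCONDITIONALLY: `exists_unitaryCentralizerGroup_invariants_le_
  divisorClassesSpan` (Milne's Cor. 4.5 package `hrec` of `WeilClassesFieldProductsDecomposable` holds for every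
  positive-dimensional `A`), **`weilClassesField_fst_le_divisorClassesSpan_of_prod_le_divisorClassesSpan`** · `…_snd_…`
  and **`weilClassesField_prod_le_divisorClassesSpan_iff`**: `W_F(A₁ × A₂, Ψ) ⊗ ℂ ≤ D^{m₁+m₂} ⊗ ℂ ⟺ W_F(A₁, corner₁Ψ) ⊗ ℂ ≤
  D^{m₁} ⊗ ℂ ∧ W_F(A₂, corner₂Ψ) ⊗ ℂ ≤ D^{m₂} ⊗ ℂ` for Hom-orthogonal positive-dimensional `A₁`, `A₂` and `P(Ψ) = 0`.

Honesty clause: criteria and equivalences; nothing here exhibits an element `u ∈ S(A)(ℂ)` with `det(u | V_ρ) ≠ 1` for any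
particular `A`, and no Weil class is proved decomposable, exceptional or algebraic outright; «simple, mutually
non-isogenous» is read as Hom-orthogonality of two factors as in the seat's earlier files.
No `sorry`; axioms `propext`, `Classical.choice`, `Quot.sound`.

## References
* [MoonenZarhin1998WeilClasses] B. J. J. Moonen, Yu. G. Zarhin, *Weil classes on abelian varieties*, J. reine angew.
  Math. 496 (1998) 83–92 = arXiv:alg-geom/9612017, §1 `G_div(X)` and Lemma (2)–(3) (chunks p0002–p0003), proof of
  Criterion (2) (chunk p0003, lines 62–70), §2 display (chunk p0002, lines 21–31).
* [Milne1999LefschetzClasses] J. S. Milne, *Lefschetz classes on abelian varieties*, Duke Math. J. 96 (1999) 639–675, §1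
  p. 644 (`S(A)`), Thm. 3.2 and Prop. 3.3 (p. 653), Prop. 3.6 (p. 655), Thm. 4.4 and Cor. 4.5 (p. 659).
* [vanGeemen1994HodgeAV] B. van Geemen, *An introduction to the Hodge conjecture for abelian varieties*, LNM 1594 (1994),
  2.4–2.5 (exceptional classes), 6.12.
-/

noncomputable section

open CategoryTheory Polynomial Module

namespace Literature.AlgebraicGeometry.HodgeTheory

open Literature.AlgebraicGeometry.Motives
open Literature.AlgebraicGeometry.VanGeemen1994 (hodgeClassSpan pullbackOne detOnEigenspace)
open Literature.AlgebraicGeometry.Milne1999 (unitaryCentralizerGroup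
  exteriorPullback_eq_self_of_mem_divisorClassesSpan_of_nondegenerate mem_hodgeClassSpan_of_forall_exteriorPullback_eq
  mem_divisorClassesSpan_of_forall_mem_unitaryCentralizerGroup)
open Literature.AlgebraicGeometry.Milne1999.CMTypeProducts (cornerFst cornerSnd)
open Literature.AlgebraicTopology.SingularHomology
open Literature.Barriers.HodgeConjecture (divisorClassesSpan)
open Literature.Geometry.Kaehler (lefschetzPow)

section HodgeTheory

variable {A : AbelianVariety ℂ} {φ : A ⟶ A} {P : Polynomial ℤ} {e m : ℕ} {h h' : complexBetti A.X 2}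

/-! ### §1 Lemma (3), third clause: the `S(A)(ℂ)`-invariants of `H^{2p}(A(ℂ); ℂ)` are exactly `Dᵖ ⊗ ℂ` -/

section LemmaThree

/-- **MOONEN–ZARHIN, LEMMA (3), THIRD CLAUSE — «`(⊕_i ⋀^i V_X)^{G_div(X)} = 𝒟^•(X)`» — as an `iff` on the carriers, with
`G_div(X)(ℂ)` read as Milne's `S(A)(ℂ)`**: for `h ∈ B¹(A) ⊗ ℂ` with `Q_h` non-degenerate on `H¹(A(ℂ); ℂ)` and a class
`c ∈ H^{2p}(A(ℂ); ℂ)`: `c ∈ Dᵖ ⊗ ℂ` iff `⋀^{2p}u c = c` for every `u ∈ unitaryCentralizerGroup A h` («⟹»: Milne Thm. 4.4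
«any `γ ∈ G(A)` will fix all divisor classes», the tree's `exteriorPullback_eq_self_of_mem_divisorClassesSpan_of_
nondegenerate`; «⟸»: Milne Thm. 3.2 / Cor. 4.5 over `ℂ`, the tree's THEOREM `mem_divisorClassesSpan_of_forall_mem_
unitaryCentralizerGroup`). [cite: MoonenZarhin1998WeilClasses, §1 Lemma (3) (chunk p0003, lines 4–5)]
[cite: Milne1999LefschetzClasses, Thm. 3.2 (p. 653), Thm. 4.4 and Cor. 4.5 (p. 659)] -/
theorem mem_divisorClassesSpan_iff_forall_unitaryCentralizerGroup_exteriorPullback_eq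
    (hh : h ∈ hodgeClassSpan A.dim A.X 1)
    (hnd : ∀ x : complexBetti A.X 1, (∀ y, polarizationPairingOne A.X h (A.dim - 1) x y = 0) → x = 0)
    (p : ℕ) (c : complexBetti A.X (2 * p)) :
    c ∈ divisorClassesSpan A.X A.dim p ↔
      ∀ u ∈ unitaryCentralizerGroup A h, exteriorPullback (AbelianVariety.hasExteriorCohomologyH1_complexPoints A)
        (u : complexBetti A.X 1 →ₗ[ℂ] complexBetti A.X 1) (2 * p) c = c :=
  ⟨fun hc _ hu => exteriorPullback_eq_self_of_mem_divisorClassesSpan_of_nondegenerate hh hnd hu p hc,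
    fun hfix => mem_divisorClassesSpan_of_forall_mem_unitaryCentralizerGroup A hh hnd p c hfix⟩

/-- **A subspace version**: a complex subspace `M ⊆ H^{2p}(A(ℂ); ℂ)` lies in `Dᵖ ⊗ ℂ` iff `S(A)(ℂ)` acts as the identity
on it. [cite: MoonenZarhin1998WeilClasses, §1 Lemma (3)] [cite: Milne1999LefschetzClasses, Thm. 3.2, Thm. 4.4, Cor. 4.5] -/
theorem le_divisorClassesSpan_iff_forall_unitaryCentralizerGroup_exteriorPullback_eq
    (hh : h ∈ hodgeClassSpan A.dim A.X 1)
    (hnd : ∀ x : complexBetti A.X 1, (∀ y, polarizationPairingOne A.X h (A.dim - 1) x y = 0) → x = 0)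
    (p : ℕ) (M : Submodule ℂ (complexBetti A.X (2 * p))) :
    M ≤ divisorClassesSpan A.X A.dim p ↔
      ∀ u ∈ unitaryCentralizerGroup A h, ∀ c ∈ M,
        exteriorPullback (AbelianVariety.hasExteriorCohomologyH1_complexPoints A)
          (u : complexBetti A.X 1 →ₗ[ℂ] complexBetti A.X 1) (2 * p) c = c :=
  ⟨fun hM u hu c hc =>
      (mem_divisorClassesSpan_iff_forall_unitaryCentralizerGroup_exteriorPullback_eq hh hnd p c).1 (hM hc) u hu,
    fun hfix c hc =>
      (mem_divisorClassesSpan_iff_forall_unitaryCentralizerGroup_exteriorPullback_eq hh hnd p c).2 fun u hu =>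
        hfix u hu c hc⟩

end LemmaThree

/-! ### §2 `W_F` decomposable ⟺ `S(A)(ℂ)` acts trivially on `W_F ⊗ ℂ` ⟺ `S(A)(ℂ) ⊂ Sl_F(V)(ℂ)` -/

section Mechanism

/-- **«`G_div(X)` acts trivially on `W_F`» ⟹ «all classes in `W_F` are decomposable», UNCONDITIONALLY** (Lemma (3) /
Milne's Thm. 3.2 in the tree): for `h ∈ B¹(A) ⊗ ℂ` with `Q_h` non-degenerate, if every `⋀^{2m}u`, `u ∈ S(A)(h)(ℂ)`, fixes
`W_F ⊗ ℂ = weilClassesField A φ P (2m)` then `W_F ⊗ ℂ ≤ Dᵐ ⊗ ℂ` (no hypothesis on `P`, `φ`).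
[cite: MoonenZarhin1998WeilClasses, §1 Lemma (3) and proof of Criterion (2) (chunk p0003, lines 62–70)]
[cite: Milne1999LefschetzClasses, Thm. 3.2 (p. 653), Cor. 4.5 (p. 659)] -/
theorem weilClassesField_le_divisorClassesSpan_of_forall_unitaryCentralizerGroup_exteriorPullback_eq
    (hh : h ∈ hodgeClassSpan A.dim A.X 1)
    (hnd : ∀ x : complexBetti A.X 1, (∀ y, polarizationPairingOne A.X h (A.dim - 1) x y = 0) → x = 0)
    (hfix : ∀ u ∈ unitaryCentralizerGroup A h, ∀ c ∈ weilClassesField A φ P (2 * m),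
      exteriorPullback (AbelianVariety.hasExteriorCohomologyH1_complexPoints A)
        (u : complexBetti A.X 1 →ₗ[ℂ] complexBetti A.X 1) (2 * m) c = c) :
    weilClassesField A φ P (2 * m) ≤ divisorClassesSpan A.X A.dim m :=
  (le_divisorClassesSpan_iff_forall_unitaryCentralizerGroup_exteriorPullback_eq hh hnd m _).2 hfix

/-- **«`W_F` consists of decomposable classes ⟺ `G_div(X)` acts as the identity on `W_F`», UNCONDITIONALLY** — the
equivalence used throughout Moonen–Zarhin's proof of Criterion (2), on the carriers with Milne's `S(A)(h)(ℂ)` for any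
`h ∈ B¹(A) ⊗ ℂ` with `Q_h` non-degenerate (no hypothesis on `P`, `φ`).
[cite: MoonenZarhin1998WeilClasses, §1 Lemma (3) and proof of Criterion (2) (chunk p0003, lines 62–70)]
[cite: Milne1999LefschetzClasses, Thm. 3.2, Thm. 4.4, Cor. 4.5 (p. 659)] -/
theorem weilClassesField_le_divisorClassesSpan_iff_forall_unitaryCentralizerGroup_exteriorPullback_eq
    (hh : h ∈ hodgeClassSpan A.dim A.X 1)
    (hnd : ∀ x : complexBetti A.X 1, (∀ y, polarizationPairingOne A.X h (A.dim - 1) x y = 0) → x = 0) :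
    weilClassesField A φ P (2 * m) ≤ divisorClassesSpan A.X A.dim m ↔
      ∀ u ∈ unitaryCentralizerGroup A h, ∀ c ∈ weilClassesField A φ P (2 * m),
        exteriorPullback (AbelianVariety.hasExteriorCohomologyH1_complexPoints A)
          (u : complexBetti A.X 1 →ₗ[ℂ] complexBetti A.X 1) (2 * m) c = c :=
  le_divisorClassesSpan_iff_forall_unitaryCentralizerGroup_exteriorPullback_eq hh hnd m _

/-- **«`G_div(X) ⊆ Sl_F(V_X)`, hence `G_div(X)` acts trivially on `W_F`» ⟹ «all classes in `W_F` are decomposable»,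
UNCONDITIONALLY**: for `P ∈ ℤ[T]` monic irreducible of degree `e`, `P(φ) = 0`, `e · 2m = 2 dim A`, `h ∈ B¹(A) ⊗ ℂ` with
`Q_h` non-degenerate: if `det(u | V_ρ) = 1` for every `u ∈ S(A)(h)(ℂ)` and every complex root `ρ` of `P`, then `W_F ⊗ ℂ ≤
Dᵐ ⊗ ℂ` (Lemma (2), converse half, `apply_eq_of_mem_weilClassesField_of_comm_of_detOnEigenspace_eq_one`, then §1).  The
tree's `weilClassesField_le_divisorClassesSpan_of_forall_detOnEigenspace_eq_one_of_isDivisorGenerated` without its `B = D`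
hypothesis. [cite: MoonenZarhin1998WeilClasses, §1 proof of Criterion (2) («Conversely …»; chunk p0003, lines 62–70)]
[cite: Milne1999LefschetzClasses, Thm. 3.2, Cor. 4.5] -/
theorem weilClassesField_le_divisorClassesSpan_of_forall_unitaryCentralizerGroup_detOnEigenspace_eq_one
    (hPm : P.Monic) (hPe : P.natDegree = e) (hPirr : Irreducible (P.map (Int.castRingHom ℚ)))
    (hφ : Polynomial.eval₂ (Int.castRingHom (CategoryTheory.End A)) (φ : CategoryTheory.End A) P = 0)
    (her : e * (2 * m) = 2 * A.dim) (hh : h ∈ hodgeClassSpan A.dim A.X 1)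
    (hnd : ∀ x : complexBetti A.X 1, (∀ y, polarizationPairingOne A.X h (A.dim - 1) x y = 0) → x = 0)
    (hdet : ∀ u (hu : u ∈ unitaryCentralizerGroup A h) (ρ : ℂ), Polynomial.eval₂ (Int.castRingHom ℂ) ρ P = 0 →
      detOnEigenspace u (pullbackOne A φ) (hu.1 φ) ρ = 1) :
    weilClassesField A φ P (2 * m) ≤ divisorClassesSpan A.X A.dim m :=
  weilClassesField_le_divisorClassesSpan_of_forall_unitaryCentralizerGroup_exteriorPullback_eq hh hnd
    fun u hu _ hc => apply_eq_of_mem_weilClassesField_of_comm_of_detOnEigenspace_eq_one hPm hPe hPirr hφ her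
      (exteriorPullback_cupPowOne_abelianVariety u _) (hu.1 φ) (hdet u hu) hc

/-- **THE MECHANISM OF CRITERION (2), UNCONDITIONALLY: «`W_F` decomposable ⟺ `G_div(X) ⊆ Sl_F(V_X)`»** — for `P ∈ ℤ[T]`
monic irreducible of degree `e`, `P(φ) = 0`, `e · 2m = 2 dim A` and `h ∈ B¹(A) ⊗ ℂ` with `Q_h` non-degenerate:
`W_F ⊗ ℂ ≤ Dᵐ ⊗ ℂ` iff `det(u | V_ρ) = 1` for every `u ∈ S(A)(h)(ℂ) = unitaryCentralizerGroup A h` and every complex root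
`ρ` of `P` («only if»: Lemmas (2) and (3) / Milne Thm. 4.4, the tree's `detOnEigenspace_eq_one_of_mem_
unitaryCentralizerGroup_of_le_divisorClassesSpan` in its non-degenerate form; «if»: the previous theorem).
[cite: MoonenZarhin1998WeilClasses, §1 Lemma (2)–(3) and proof of Criterion (2) (chunk p0003, lines 12–70)]
[cite: Milne1999LefschetzClasses, Thm. 3.2, Thm. 4.4, Cor. 4.5 (p. 659)] -/
theorem weilClassesField_le_divisorClassesSpan_iff_forall_detOnEigenspace_eq_one
    (hPm : P.Monic) (hPe : P.natDegree = e) (hPirr : Irreducible (P.map (Int.castRingHom ℚ)))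
    (hφ : Polynomial.eval₂ (Int.castRingHom (CategoryTheory.End A)) (φ : CategoryTheory.End A) P = 0)
    (her : e * (2 * m) = 2 * A.dim) (hh : h ∈ hodgeClassSpan A.dim A.X 1)
    (hnd : ∀ x : complexBetti A.X 1, (∀ y, polarizationPairingOne A.X h (A.dim - 1) x y = 0) → x = 0) :
    weilClassesField A φ P (2 * m) ≤ divisorClassesSpan A.X A.dim m ↔
      ∀ u (hu : u ∈ unitaryCentralizerGroup A h) (ρ : ℂ), Polynomial.eval₂ (Int.castRingHom ℂ) ρ P = 0 →
        detOnEigenspace u (pullbackOne A φ) (hu.1 φ) ρ = 1 := by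
  refine ⟨fun hW u hu ρ hρ => ?_,
    weilClassesField_le_divisorClassesSpan_of_forall_unitaryCentralizerGroup_detOnEigenspace_eq_one hPm hPe hPirr hφ her
      hh hnd⟩
  -- «only if»: `⋀^{2m}u` fixes `Dᵐ ⊗ ℂ ⊇ W_F ⊗ ℂ` (Milne 4.4), hence `det(u | V_ρ) = 1` (Lemma (2))
  obtain ⟨ω, hω, hω0, -, -⟩ := exists_generator_pullbackEigenclasses_of_root hPm hPe hPirr hφ her hρ
  have hdet := apply_eq_detOnEigenspace_smul_of_comm hPm hPe hPirr hφ her (exteriorPullback_cupPowOne_abelianVariety u _)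
    (hu.1 φ) hρ hω
  rw [exteriorPullback_eq_self_of_mem_divisorClassesSpan_of_nondegenerate hh hnd hu m
    (hW (pullbackEigenclasses_le_weilClassesField hρ hω))] at hdet
  exact (smul_left_injective ℂ hω0 ((one_smul ℂ ω).trans hdet)).symm

/-- **«The group `G_div(X)` does not depend on the choice of `λ`», in the form the Criterion uses**: for two classes
`h, h' ∈ B¹(A) ⊗ ℂ` with non-degenerate `Q_h`, `Q_{h'}` (e.g. two polarization classes), `S(A)(h)(ℂ) ⊂ Sl_F(V)(ℂ)` iff
`S(A)(h')(ℂ) ⊂ Sl_F(V)(ℂ)` — both say `W_F ⊗ ℂ ≤ Dᵐ ⊗ ℂ`. [cite: MoonenZarhin1998WeilClasses, §1 (chunk p0002, line 72: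
«The group G_div(X) does not depend on the choice of λ») and proof of Criterion (2)] -/
theorem forall_detOnEigenspace_eq_one_iff_of_nondegenerate
    (hPm : P.Monic) (hPe : P.natDegree = e) (hPirr : Irreducible (P.map (Int.castRingHom ℚ)))
    (hφ : Polynomial.eval₂ (Int.castRingHom (CategoryTheory.End A)) (φ : CategoryTheory.End A) P = 0)
    (her : e * (2 * m) = 2 * A.dim) (hh : h ∈ hodgeClassSpan A.dim A.X 1)
    (hnd : ∀ x : complexBetti A.X 1, (∀ y, polarizationPairingOne A.X h (A.dim - 1) x y = 0) → x = 0)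
    (hh' : h' ∈ hodgeClassSpan A.dim A.X 1)
    (hnd' : ∀ x : complexBetti A.X 1, (∀ y, polarizationPairingOne A.X h' (A.dim - 1) x y = 0) → x = 0) :
    (∀ u (hu : u ∈ unitaryCentralizerGroup A h) (ρ : ℂ), Polynomial.eval₂ (Int.castRingHom ℂ) ρ P = 0 →
        detOnEigenspace u (pullbackOne A φ) (hu.1 φ) ρ = 1) ↔
      ∀ u (hu : u ∈ unitaryCentralizerGroup A h') (ρ : ℂ), Polynomial.eval₂ (Int.castRingHom ℂ) ρ P = 0 →
        detOnEigenspace u (pullbackOne A φ) (hu.1 φ) ρ = 1 := by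
  rw [← weilClassesField_le_divisorClassesSpan_iff_forall_detOnEigenspace_eq_one hPm hPe hPirr hφ her hh hnd,
    ← weilClassesField_le_divisorClassesSpan_iff_forall_detOnEigenspace_eq_one hPm hPe hPirr hφ her hh' hnd']

end Mechanism

/-! ### §3 The exceptional alternative, as an `iff` -/

section Exceptional

/-- **«All non-zero classes in `W_F` are exceptional» ⟺ SOME `u ∈ G_div(X)(ℂ)` HAS `det(u | V_ρ) ≠ 1` AT SOME ROOT**
(`m ≠ 0`; `h ∈ B¹(A) ⊗ ℂ` with `Q_h` non-degenerate): `W_F ⊗ ℂ ⊓ Dᵐ ⊗ ℂ = ⊥` iff there are `u ∈ S(A)(h)(ℂ)` and a complex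
root `ρ` of `P` with `det(u | V_ρ) ≠ 1` («⟸» is the tree's `weilClassesField_inf_divisorClassesSpan_eq_bot_of_
detOnEigenspace_ne_one` in non-degenerate form; «⟹»: otherwise `W_F ⊗ ℂ ≤ Dᵐ ⊗ ℂ` by §2, while `W_F ⊗ ℂ ≠ 0`).
[cite: MoonenZarhin1998WeilClasses, §1 Criterion (2) («or all non-zero classes in W_F are exceptional») and its proof]
[cite: Milne1999LefschetzClasses, Thm. 3.2, Cor. 4.5] -/
theorem weilClassesField_inf_divisorClassesSpan_eq_bot_iff_exists_detOnEigenspace_ne_one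
    (hPm : P.Monic) (hPe : P.natDegree = e) (hPirr : Irreducible (P.map (Int.castRingHom ℚ)))
    (hφ : Polynomial.eval₂ (Int.castRingHom (CategoryTheory.End A)) (φ : CategoryTheory.End A) P = 0)
    (her : e * (2 * m) = 2 * A.dim) (hm : m ≠ 0) (hh : h ∈ hodgeClassSpan A.dim A.X 1)
    (hnd : ∀ x : complexBetti A.X 1, (∀ y, polarizationPairingOne A.X h (A.dim - 1) x y = 0) → x = 0) :
    weilClassesField A φ P (2 * m) ⊓ divisorClassesSpan A.X A.dim m = ⊥ ↔
      ∃ (u : complexBetti A.X 1 ≃ₗ[ℂ] complexBetti A.X 1) (hu : u ∈ unitaryCentralizerGroup A h) (ρ : ℂ),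
        Polynomial.eval₂ (Int.castRingHom ℂ) ρ P = 0 ∧ detOnEigenspace u (pullbackOne A φ) (hu.1 φ) ρ ≠ 1 := by
  refine ⟨fun hbot => ?_, fun ⟨u, hu, ρ, hρ, hdet⟩ => ?_⟩
  · by_contra hne
    push Not at hne
    have hle : weilClassesField A φ P (2 * m) ≤ divisorClassesSpan A.X A.dim m :=
      weilClassesField_le_divisorClassesSpan_of_forall_unitaryCentralizerGroup_detOnEigenspace_eq_one hPm hPe hPirr hφ
        her hh hnd hne
    obtain ⟨γ, hγW, -, hγ0⟩ := exists_isRationalClass_ne_zero_mem_weilClassesField hPm hPe hPirr hφ her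
    have h0 : γ ∈ weilClassesField A φ P (2 * m) ⊓ divisorClassesSpan A.X A.dim m := ⟨hγW, hle hγW⟩
    rw [hbot, Submodule.mem_bot] at h0
    exact hγ0 h0
  · rcases weilClassesField_inf_divisorClassesSpan_eq_bot_or_le hPe hPirr hφ her hm with hbot | hle
    · exact hbot
    · exact absurd ((weilClassesField_le_divisorClassesSpan_iff_forall_detOnEigenspace_eq_one hPm hPe hPirr hφ her hh
        hnd).1 hle u hu ρ hρ) hdet

/-- **THE HODGE-BUT-EXCEPTIONAL LOCUS, READ ON THE GROUPS** (`m ≠ 0`; `h ∈ B¹(A) ⊗ ℂ` with `Q_h` non-degenerate): `W_F`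
consists of Hodge classes all of whose non-zero members are exceptional — `W_F ⊗ ℂ ≤ Bᵐ ⊗ ℂ` and `W_F ⊗ ℂ ⊓ Dᵐ ⊗ ℂ = ⊥`
— iff the multiplicities are balanced (`n_ρ = n_ρ̄` at every complex root: Criterion (1), the tree's `Deligne1982.
weilClassesField_le_hodgeClassSpan_iff_forall_eigenMultiplicity_eq`) and some `u ∈ S(A)(h)(ℂ)` has `det(u | V_ρ) ≠ 1` at
some root. [cite: MoonenZarhin1998WeilClasses, §1 Criterion (1) and Criterion (2) with its proof]
[cite: Milne1999LefschetzClasses, Thm. 3.2, Cor. 4.5] -/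
theorem weilClassesField_le_hodgeClassSpan_and_inf_eq_bot_iff
    (hPm : P.Monic) (hPe : P.natDegree = e) (hPirr : Irreducible (P.map (Int.castRingHom ℚ)))
    (hφ : Polynomial.eval₂ (Int.castRingHom (CategoryTheory.End A)) (φ : CategoryTheory.End A) P = 0)
    (her : e * (2 * m) = 2 * A.dim) (hm : m ≠ 0) (hh : h ∈ hodgeClassSpan A.dim A.X 1)
    (hnd : ∀ x : complexBetti A.X 1, (∀ y, polarizationPairingOne A.X h (A.dim - 1) x y = 0) → x = 0) :
    (weilClassesField A φ P (2 * m) ≤ hodgeClassSpan A.dim A.X m ∧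
        weilClassesField A φ P (2 * m) ⊓ divisorClassesSpan A.X A.dim m = ⊥) ↔
      (∀ ρ : ℂ, Polynomial.eval₂ (Int.castRingHom ℂ) ρ P = 0 →
          eigenMultiplicity A φ ρ = eigenMultiplicity A φ (starRingEnd ℂ ρ)) ∧
        ∃ (u : complexBetti A.X 1 ≃ₗ[ℂ] complexBetti A.X 1) (hu : u ∈ unitaryCentralizerGroup A h) (ρ : ℂ),
          Polynomial.eval₂ (Int.castRingHom ℂ) ρ P = 0 ∧ detOnEigenspace u (pullbackOne A φ) (hu.1 φ) ρ ≠ 1 := by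
  rw [Deligne1982.weilClassesField_le_hodgeClassSpan_iff_forall_eigenMultiplicity_eq hPm hPe hPirr hφ her,
    weilClassesField_inf_divisorClassesSpan_eq_bot_iff_exists_detOnEigenspace_ne_one hPm hPe hPirr hφ her hm hh hnd]

/-- **THE DECOMPOSABLE LOCUS IMPLIES THE HODGE LOCUS ON THE GROUPS**: if `det(u | V_ρ) = 1` for all `u ∈ S(A)(h)(ℂ)` and
all roots, then `n_ρ = n_ρ̄` at every root and NO `u ∈ S(A)(h')(ℂ)`, for any other non-degenerate `h'`, has
`det(u | V_ρ) ≠ 1` (`m ≠ 0`). [cite: MoonenZarhin1998WeilClasses, §1 Criterion (2) and its proof] -/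
theorem not_exists_detOnEigenspace_ne_one_of_forall_detOnEigenspace_eq_one
    (hPm : P.Monic) (hPe : P.natDegree = e) (hPirr : Irreducible (P.map (Int.castRingHom ℚ)))
    (hφ : Polynomial.eval₂ (Int.castRingHom (CategoryTheory.End A)) (φ : CategoryTheory.End A) P = 0)
    (her : e * (2 * m) = 2 * A.dim) (hm : m ≠ 0) (hh : h ∈ hodgeClassSpan A.dim A.X 1)
    (hnd : ∀ x : complexBetti A.X 1, (∀ y, polarizationPairingOne A.X h (A.dim - 1) x y = 0) → x = 0)
    (hh' : h' ∈ hodgeClassSpan A.dim A.X 1)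
    (hnd' : ∀ x : complexBetti A.X 1, (∀ y, polarizationPairingOne A.X h' (A.dim - 1) x y = 0) → x = 0)
    (hdet : ∀ u (hu : u ∈ unitaryCentralizerGroup A h) (ρ : ℂ), Polynomial.eval₂ (Int.castRingHom ℂ) ρ P = 0 →
      detOnEigenspace u (pullbackOne A φ) (hu.1 φ) ρ = 1) :
    (∀ ρ : ℂ, Polynomial.eval₂ (Int.castRingHom ℂ) ρ P = 0 →
        eigenMultiplicity A φ ρ = eigenMultiplicity A φ (starRingEnd ℂ ρ)) ∧
      ¬ ∃ (u : complexBetti A.X 1 ≃ₗ[ℂ] complexBetti A.X 1) (hu : u ∈ unitaryCentralizerGroup A h') (ρ : ℂ),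
          Polynomial.eval₂ (Int.castRingHom ℂ) ρ P = 0 ∧ detOnEigenspace u (pullbackOne A φ) (hu.1 φ) ρ ≠ 1 := by
  have hle := weilClassesField_le_divisorClassesSpan_of_forall_unitaryCentralizerGroup_detOnEigenspace_eq_one hPm hPe
    hPirr hφ her hh hnd hdet
  refine ⟨fun ρ hρ => forall_eigenMultiplicity_eq_of_forall_unitaryCentralizerGroup_detOnEigenspace_eq_one hPm hPe
    hPirr hφ her hh hdet hρ, fun hex => ?_⟩
  have hbot := (weilClassesField_inf_divisorClassesSpan_eq_bot_iff_exists_detOnEigenspace_ne_one hPm hPe hPirr hφ her hm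
    hh' hnd').2 hex
  obtain ⟨γ, hγW, -, hγ0⟩ := exists_isRationalClass_ne_zero_mem_weilClassesField hPm hPe hPirr hφ her
  have h0 : γ ∈ weilClassesField A φ P (2 * m) ⊓ divisorClassesSpan A.X A.dim m := ⟨hγW, hle hγW⟩
  rw [hbot, Submodule.mem_bot] at h0
  exact hγ0 h0

end Exceptional

/-! ### §4 The §2 display for two Hom-orthogonal factors, unconditionally -/

section Display

variable {A₁ A₂ : AbelianVariety ℂ} {Ψ : A₁.prod A₂ ⟶ A₁.prod A₂} {r₁ r₂ m₁ m₂ : ℕ}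

/-- **Milne's Cor. 4.5 package for EVERY positive-dimensional complex abelian variety** — the hypothesis `hrec` of
`WeilClassesFieldProductsDecomposable` §4–§5: some `D ∈ B¹(A) ⊗ ℂ` with `D^{dim A} ≠ 0`, `Q_D` non-degenerate, whose
`S(A)(D)(ℂ)`-invariants in every even degree are Lefschetz classes; DISCHARGED by a polarization class
(`Milne1999.exists_polarizationClass`) and the tree's theorem `mem_divisorClassesSpan_of_forall_mem_unitaryCentralizerGroup`.
[cite: Milne1999LefschetzClasses, §1 p. 642 (e_D for D ample), Thm. 3.2, Cor. 4.5 (p. 659)] -/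
theorem exists_unitaryCentralizerGroup_invariants_le_divisorClassesSpan (A : AbelianVariety ℂ) (hA0 : 0 < A.dim) :
    ∃ D : complexBetti A.X 2, D ∈ hodgeClassSpan A.dim A.X 1 ∧ lefschetzPow D (A.dim - 1) 2 D ≠ 0 ∧
      (∀ z : complexBetti A.X 1, (∀ y, polarizationPairingOne A.X D (A.dim - 1) z y = 0) → z = 0) ∧
      ∀ (a : ℕ) (y : complexBetti A.X (2 * a)), (∀ u ∈ unitaryCentralizerGroup A D,
        exteriorPullback (AbelianVariety.hasExteriorCohomologyH1_complexPoints A)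
          (u : complexBetti A.X 1 →ₗ[ℂ] complexBetti A.X 1) (2 * a) y = y) → y ∈ divisorClassesSpan A.X A.dim a := by
  obtain ⟨D, -, -, hDB, hDtop, hDnd⟩ := Milne1999.exists_polarizationClass A hA0
  exact ⟨D, hDB, hDtop, hDnd, fun a y hy => mem_divisorClassesSpan_of_forall_mem_unitaryCentralizerGroup A hDB hDnd a y hy⟩

/-- **`W_F(A₁ × A₂)` decomposable ⟹ `W_F(A₁, corner₁Ψ)` decomposable, UNCONDITIONALLY**: for Hom-orthogonal
positive-dimensional `A₁`, `A₂`, `P ∈ ℤ[T]` monic irreducible of degree `e` with `P(Ψ) = 0`, `e · r₂ = 2 dim A₂`,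
`2m₁ + r₂ = 2m`: `W_F(A₁ × A₂, Ψ) ⊗ ℂ ≤ Dᵐ ⊗ ℂ ⟹ W_F(A₁, corner₁Ψ) ⊗ ℂ ≤ D^{m₁} ⊗ ℂ` («`W_F(X)` consists of decomposable
Hodge classes ⟹ each of the spaces `W_F(Yᵢ^{mᵢ})` consists of decomposable Hodge classes»; the tree's `…_of_exists` with
its package hypothesis discharged). [cite: MoonenZarhin1998WeilClasses, §2 display (chunk p0002, lines 21–31)]
[cite: Milne1999LefschetzClasses, Thm. 3.2, Cor. 4.5 (p. 659)] -/
theorem weilClassesField_fst_le_divisorClassesSpan_of_prod_le_divisorClassesSpan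
    (hAB : ∀ f : A₁ ⟶ A₂, f = 0) (hBA : ∀ g : A₂ ⟶ A₁, g = 0) (hA₁0 : 0 < A₁.dim) (hA₂0 : 0 < A₂.dim)
    (hPm : P.Monic) (hPe : P.natDegree = e) (hPirr : Irreducible (P.map (Int.castRingHom ℚ)))
    (hΨ : Polynomial.eval₂ (Int.castRingHom (CategoryTheory.End (A₁.prod A₂)))
      (Ψ : CategoryTheory.End (A₁.prod A₂)) P = 0)
    (her₂ : e * r₂ = 2 * A₂.dim) (hk : 2 * m₁ + r₂ = 2 * m)
    (hW : weilClassesField (A₁.prod A₂) Ψ P (2 * m) ≤ divisorClassesSpan (A₁.prod A₂).X (A₁.prod A₂).dim m) :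
    weilClassesField A₁ (cornerFst A₁ A₂ Ψ) P (2 * m₁) ≤ divisorClassesSpan A₁.X A₁.dim m₁ :=
  weilClassesField_fst_le_divisorClassesSpan_of_prod_le_divisorClassesSpan_of_exists hAB hBA hA₁0 hA₂0 hPm hPe hPirr hΨ
    her₂ hk (exists_unitaryCentralizerGroup_invariants_le_divisorClassesSpan A₁ hA₁0) hW

/-- **`W_F(A₁ × A₂)` decomposable ⟹ `W_F(A₂, corner₂Ψ)` decomposable, UNCONDITIONALLY** (`e · r₁ = 2 dim A₁`,
`e · 2m₂ = 2 dim A₂`, `r₁ + 2m₂ = 2m`). [cite: MoonenZarhin1998WeilClasses, §2 display (chunk p0002, lines 21–31)]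
[cite: Milne1999LefschetzClasses, Thm. 3.2, Cor. 4.5 (p. 659)] -/
theorem weilClassesField_snd_le_divisorClassesSpan_of_prod_le_divisorClassesSpan
    (hAB : ∀ f : A₁ ⟶ A₂, f = 0) (hBA : ∀ g : A₂ ⟶ A₁, g = 0) (hA₁0 : 0 < A₁.dim) (hA₂0 : 0 < A₂.dim)
    (hPm : P.Monic) (hPe : P.natDegree = e) (hPirr : Irreducible (P.map (Int.castRingHom ℚ)))
    (hΨ : Polynomial.eval₂ (Int.castRingHom (CategoryTheory.End (A₁.prod A₂)))
      (Ψ : CategoryTheory.End (A₁.prod A₂)) P = 0)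
    (her₁ : e * r₁ = 2 * A₁.dim) (her₂ : e * (2 * m₂) = 2 * A₂.dim) (hk : r₁ + 2 * m₂ = 2 * m)
    (hW : weilClassesField (A₁.prod A₂) Ψ P (2 * m) ≤ divisorClassesSpan (A₁.prod A₂).X (A₁.prod A₂).dim m) :
    weilClassesField A₂ (cornerSnd A₁ A₂ Ψ) P (2 * m₂) ≤ divisorClassesSpan A₂.X A₂.dim m₂ :=
  weilClassesField_snd_le_divisorClassesSpan_of_prod_le_divisorClassesSpan_of_exists hAB hBA hA₁0 hA₂0 hPm hPe hPirr hΨ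
    her₁ her₂ hk (exists_unitaryCentralizerGroup_invariants_le_divisorClassesSpan A₂ hA₂0) hW

/-- **MOONEN–ZARHIN'S §2 DISPLAY FOR TWO HOM-ORTHOGONAL FACTORS, UNCONDITIONALLY:
`W_F(A₁ × A₂, Ψ) ⊗ ℂ ≤ D^{m₁+m₂} ⊗ ℂ ⟺ W_F(A₁, corner₁Ψ) ⊗ ℂ ≤ D^{m₁} ⊗ ℂ ∧ W_F(A₂, corner₂Ψ) ⊗ ℂ ≤ D^{m₂} ⊗ ℂ`** for
Hom-orthogonal positive-dimensional `A₁`, `A₂` (`Hom(A₁, A₂) = 0 = Hom(A₂, A₁)`), `P ∈ ℤ[T]` monic irreducible of degree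
`e` with `P(Ψ) = 0`, `e · 2m₁ = 2 dim A₁`, `e · 2m₂ = 2 dim A₂` («⟸» is the tree's `weilClassesField_prod_le_
divisorClassesSpan_of_orthogonal`; «⟹» the two previous theorems).  The tree's `…_iff_of_exists` /
`…_iff_of_isDivisorGenerated` without their package / `B = D` hypotheses.
[cite: MoonenZarhin1998WeilClasses, §2 display (chunk p0002, lines 21–31)] [cite: Milne1999LefschetzClasses, Cor. 4.5] -/
theorem weilClassesField_prod_le_divisorClassesSpan_iff
    (hAB : ∀ f : A₁ ⟶ A₂, f = 0) (hBA : ∀ g : A₂ ⟶ A₁, g = 0) (hA₁0 : 0 < A₁.dim) (hA₂0 : 0 < A₂.dim)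
    (hPm : P.Monic) (hPe : P.natDegree = e) (hPirr : Irreducible (P.map (Int.castRingHom ℚ)))
    (hΨ : Polynomial.eval₂ (Int.castRingHom (CategoryTheory.End (A₁.prod A₂)))
      (Ψ : CategoryTheory.End (A₁.prod A₂)) P = 0)
    (her₁ : e * (2 * m₁) = 2 * A₁.dim) (her₂ : e * (2 * m₂) = 2 * A₂.dim) :
    weilClassesField (A₁.prod A₂) Ψ P (2 * (m₁ + m₂)) ≤
        divisorClassesSpan (A₁.prod A₂).X (A₁.prod A₂).dim (m₁ + m₂) ↔
      weilClassesField A₁ (cornerFst A₁ A₂ Ψ) P (2 * m₁) ≤ divisorClassesSpan A₁.X A₁.dim m₁ ∧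
        weilClassesField A₂ (cornerSnd A₁ A₂ Ψ) P (2 * m₂) ≤ divisorClassesSpan A₂.X A₂.dim m₂ :=
  weilClassesField_prod_le_divisorClassesSpan_iff_of_exists hAB hBA hA₁0 hA₂0 hPm hPe hPirr hΨ her₁ her₂
    (exists_unitaryCentralizerGroup_invariants_le_divisorClassesSpan A₁ hA₁0)
    (exists_unitaryCentralizerGroup_invariants_le_divisorClassesSpan A₂ hA₂0)

/-- **The display read contrapositively: an exceptional factor makes the product exceptional** (`m₁ ≠ 0`): if
`W_F(A₁, corner₁Ψ) ⊗ ℂ ⊓ D^{m₁} ⊗ ℂ = ⊥` then `W_F(A₁ × A₂, Ψ) ⊗ ℂ ⊓ D^{m₁+m₂} ⊗ ℂ = ⊥` (all-or-nothing on both sides).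
[cite: MoonenZarhin1998WeilClasses, §2 display and §1 «all or nothing» (chunks p0001–p0002)] -/
theorem weilClassesField_prod_inf_divisorClassesSpan_eq_bot_of_fst
    (hAB : ∀ f : A₁ ⟶ A₂, f = 0) (hBA : ∀ g : A₂ ⟶ A₁, g = 0) (hA₁0 : 0 < A₁.dim) (hA₂0 : 0 < A₂.dim)
    (hPm : P.Monic) (hPe : P.natDegree = e) (hPirr : Irreducible (P.map (Int.castRingHom ℚ)))
    (hΨ : Polynomial.eval₂ (Int.castRingHom (CategoryTheory.End (A₁.prod A₂)))
      (Ψ : CategoryTheory.End (A₁.prod A₂)) P = 0)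
    (her₁ : e * (2 * m₁) = 2 * A₁.dim) (her₂ : e * (2 * m₂) = 2 * A₂.dim) (hm₁ : m₁ ≠ 0)
    (hbot : weilClassesField A₁ (cornerFst A₁ A₂ Ψ) P (2 * m₁) ⊓ divisorClassesSpan A₁.X A₁.dim m₁ = ⊥) :
    weilClassesField (A₁.prod A₂) Ψ P (2 * (m₁ + m₂)) ⊓
        divisorClassesSpan (A₁.prod A₂).X (A₁.prod A₂).dim (m₁ + m₂) = ⊥ := by
  have hcorner : Polynomial.eval₂ (Int.castRingHom (CategoryTheory.End A₁)) (cornerFst A₁ A₂ Ψ : CategoryTheory.End A₁)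
      P = 0 := eval₂_cornerFst_eq_zero_of_orthogonal hAB hBA hΨ
  have hdim : e * (2 * (m₁ + m₂)) = 2 * (A₁.prod A₂).dim := by
    rw [AbelianVariety.dim_prod, mul_add, mul_add, her₁, her₂, mul_add]
  rcases weilClassesField_inf_divisorClassesSpan_eq_bot_or_le hPe hPirr hΨ hdim (by omega) with h | hle
  · exact h
  · exfalso
    have hle₁ := ((weilClassesField_prod_le_divisorClassesSpan_iff hAB hBA hA₁0 hA₂0 hPm hPe hPirr hΨ her₁ her₂).1 hle).1
    obtain ⟨γ, hγW, -, hγ0⟩ := exists_isRationalClass_ne_zero_mem_weilClassesField hPm hPe hPirr hcorner her₁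
    have h0 : γ ∈ weilClassesField A₁ (cornerFst A₁ A₂ Ψ) P (2 * m₁) ⊓ divisorClassesSpan A₁.X A₁.dim m₁ :=
      ⟨hγW, hle₁ hγW⟩
    rw [hbot, Submodule.mem_bot] at h0
    exact hγ0 h0

end Display

end HodgeTheory

end Literature.AlgebraicGeometry.HodgeTheory

end
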